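import Summits.KontsevichZagierPeriods.Zeta5Search.LaiSweepShard

/-!
# `κ₃` sweep certificate — shard file 009 of 127 (shards 63–69 of 889)

HONEST FRAMING. Systematic search; no irrationality claim unless certified. This file only checks,
by `decide +kernel`, shards 63–69 of the order-cell sweep of the `κ₃` point `(74, 2180, 444; δ74)`
(engine `LaiSweepEngine`, soundness `LaiSweepJump/Free/Eval/Shard/Kappa3`; a shard is `⟨regime, n,
p, q, p', q', Lo, Up⟩`: `n` cells from `p/q` to `p'/q'` with integer rate sums in `[Lo, Up]`, `K =
128`, `D = 2^40`). It draws NO conclusion: only the capstone `LaiKappa3SweepCert`, which needs all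
127 shard files, does. Kernel cost of this file ≈ 560 cells × 0.3 s.
-/

namespace Summit.KontsevichZagierPeriods.Zeta5Search.Sweep

set_option maxHeartbeats 100000000 in
/-- Shard 63: 80 cells of regime A from `22/1275` to `13/744`.
[cite: Lai2024BallRivoal, §4 Lemma 4.3] -/
theorem shard063 :
    Shard.check 128 (2^40)
      ⟨false, 80, 22, 1275, 13, 744, 83994193357713, 84023604604417⟩ = true := by
  decide +kernel

set_option maxHeartbeats 100000000 in
/-- Shard 64: 80 cells of regime A from `13/744` to `20/1129`.
[cite: Lai2024BallRivoal, §4 Lemma 4.3] -/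
theorem shard064 :
    Shard.check 128 (2^40)
      ⟨false, 80, 13, 744, 20, 1129, 88919346847496, 88951984054961⟩ = true := by
  decide +kernel

set_option maxHeartbeats 100000000 in
/-- Shard 65: 80 cells of regime A from `20/1129` to `3/167`.
[cite: Lai2024BallRivoal, §4 Lemma 4.3] -/
theorem shard065 :
    Shard.check 128 (2^40)
      ⟨false, 80, 20, 1129, 3, 167, 89799745232098, 89837812080757⟩ = true := by
  decide +kernel

set_option maxHeartbeats 100000000 in
/-- Shard 66: 80 cells of regime A from `3/167` to `23/1264`.
[cite: Lai2024BallRivoal, §4 Lemma 4.3] -/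
theorem shard066 :
    Shard.check 128 (2^40)
      ⟨false, 80, 3, 167, 23, 1264, 81426827615224, 81456115169674⟩ = true := by
  decide +kernel

set_option maxHeartbeats 100000000 in
/-- Shard 67: 80 cells of regime A from `23/1264` to `7/380`.
[cite: Lai2024BallRivoal, §4 Lemma 4.3] -/
theorem shard067 :
    Shard.check 128 (2^40)
      ⟨false, 80, 23, 1264, 7, 380, 77244268758888, 77271685704468⟩ = true := by
  decide +kernel

set_option maxHeartbeats 100000000 in
/-- Shard 68: 80 cells of regime A from `7/380` to `21/1123`.
[cite: Lai2024BallRivoal, §4 Lemma 4.3] -/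
theorem shard068 :
    Shard.check 128 (2^40)
      ⟨false, 80, 7, 380, 21, 1123, 101656050836243, 101703274261761⟩ = true := by
  decide +kernel

set_option maxHeartbeats 100000000 in
/-- Shard 69: 80 cells of regime A from `21/1123` to `49/2586`.
[cite: Lai2024BallRivoal, §4 Lemma 4.3] -/
theorem shard069 :
    Shard.check 128 (2^40)
      ⟨false, 80, 21, 1123, 49, 2586, 89155299700301, 89188900254574⟩ = true := by
  decide +kernel

/-- The checked shards of this file, in order. [folklore] -/
def shards009 : List (CheckedShard 128 (2^40)) :=
  [⟨_, shard063⟩, ⟨_, shard064⟩, ⟨_, shard065⟩, ⟨_, shard066⟩, ⟨_, shard067⟩,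
    ⟨_, shard068⟩, ⟨_, shard069⟩]

end Summit.KontsevichZagierPeriods.Zeta5Search.Sweep
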